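import Summits.QuantumFields.BalabanUV.Beta.GAN24.CubicGaugeLetterLinearGrowth
import Summits.QuantumFields.BalabanUV.Beta.GAN24.RespGaugeStencil

/-!
# `BalabanUV.Beta.GAN24.ExitFaceHalfVertexSplit` — binder row G-an2-4 ∕ (CONV-C), W-slot (α-0), ROW (C) AT LEVELS `j ≥ 1`, letter (W2)+(W3) of the (γ) hand's memo
# `HOME/b2b-balaban-gan24-formalise-leaf-06/g52/C-LEVELS-GE1.md` §17: **THE E-SECTOR HALF-VERTEX AT THE EXIT-FACE BACKGROUND SPLITS INTO THE CONSTANT-BACKGROUND FACE CURRENT AND A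
# VALUE-HESSIAN IMAGE OF THE SAWTOOTH** — for `V_j := e3OfK Lc G_j (SrecAt … j)`, the exit-face indicator `χ_ν(t) = [t_ν % Lc = Lc−1]` and the sawtooth `λ_ν(t) = t_ν % Lc`:
# `Σ'_t χ_ν(t)·V_j ν t (z,s′)_{bβ} = Lc⁻¹·Σ'_t V_j ν t (z,s′)_{bβ} − (2Lc)⁻¹·E2_{j+1}(z,s′)_{bβ}·(λ_ν s′ − λ_ν z)` (every leg pair), and against the exit-face leg weight `χ_β(s′)` the
# `λ_ν(z)`-term dies: `Σ'_{s′} χ_β(s′)·Σ'_t χ_ν(t)·V_j ν t (z,s′)_{bβ} = Lc⁻¹·Σ'_{s′} χ_β(s′)·Σ'_t V_j ν t (z,s′)_{bβ} − (2Lc)⁻¹·Σ'_{s′} E2_{j+1}(z,s′)_{bβ}·λ_ν(s′)χ_β(s′)`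
# (every `j`, in-block root, every `d`, `Lc ≥ 1`; leaf-04's two-face currency `RespGaugeStencil` ∕ `DressedHalfVertex`)
# (G-an2-4 CRUX TEAM (2), seat `b2b-balaban-gan24-formalise-leaf-06` = the (γ) hand, gen 52; journal INTENT I-leaf06-g52-5)

NOT IN PRINT; OUR BOOKKEEPING ([folklore] BY NAME: this lineage's L1′ `CubicGaugeLetterLinearGrowth.tsum_grad_mul_e3OfK_SrecAt_inl_inl` and D1
`ValueHessianLinearGauge.tsum_E2_mul_exitFace_eq_zero'` ∕ `summable_decay_mul_of_linGrowth`, leaf-04's `RespGaugeStencil.summable_faceStencil_slot` ∕ `decays_faceStencil` ∕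
`decays_tsum_of_biLoc_family`, an2's `locStencil_e3OfK`, leaf-10's `locStencil_SrecAt`, `decays_E2`; 0 `def`, 0 cited fact, 0 `def … : Prop`, 0 sorry).
HONEST FRAMING (cell contract, verbatim): «discharging `BetaPertH` makes Bałaban's UV stability UNCONDITIONAL — a real constructive-QFT result; it is NOT the continuum
limit and NOT the Clay problem.»  HONEST DEPENDENCY (verbatim): «continuum YM on T⁴ ⇐ BetaPertH ∧ nine spine estimates (0/9 proved); BetaPertH ⇐ (D1) ∧ (D4) ∧ CAP+tail;
G-an2-4 gates asym, D1 and NE2/3/4.»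

WHY (memo §17 (W1)–(W3)).  leaf-04's LEVEL-GENERIC slot resummation `DressedHalfVertex.hasSum_vertexOfK_dressedStep` turns the right slot of the direct exchange word of `zmode Lc b̃_j` into
`c₀σ_j·Σ'_t χ_ν(t)·S ν t` — the first-order table at the EXIT-FACE background; the dressed legs carry the exit-face weight `χ_β` (`DressedStepFaceCharges`).  For the E-sector
`S^E_j = (cE·wE_j)•V_j` the exit-face profile is `Lc⁻¹(c_ν − dλ_ν)` with the sawtooth `λ_ν(t) = t_ν % Lc` (§1: `sawtooth_grad`), so by L1′ the face-background half-vertex is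
`Lc⁻¹×`(the CONSTANT-background slot sum — the tower object `τ`, left displayed) `− (2Lc)⁻¹×`(the commutator `E2_{j+1}(z,s′)(λ_ν s′ − λ_ν z)`), §2; against the exit-face leg weight the
`λ_ν(z)` half of the commutator is `λ_ν(z)·Σ'_{s′} E2_{j+1}(z,s′)χ_β(s′) = 0` (D1: the value Hessian kills the exit-face profile), §3 — leaving the datum `E2_{j+1}(λ_ν ⊙ χ_β)` whose
sandwich L4′ evaluates and whose block contour sums D1 §4 kills across directions.
* §1 `sawtooth_grad` (`λ_ν(t + e_κ) − λ_ν(t) = [κ = ν]·(1 − Lc·χ_ν(t))`), `abs_sawtooth_le` (bounded: `≤ Lc + 0·|t|₁`); the centred twins `csawtooth_grad` ∕ `abs_csawtooth_le` (`t_ν % Lc − c`,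
  the zero-mean form `c = (Lc−1)∕2` that `ValueHessianLinearGauge.contourSum_periodic_mul_exitFace_eq_zero` wants — plug them into §2–§4's generic `lam`).
* §2 **`faceSlot_e3OfK_split`** — the first display of the title, for every `λ` with that gradient and linear growth; **`faceSlot_e3OfK_split_sawtooth`** — the sawtooth instance.
* §3 `summable_E2_mul_linGrowth_face`, **`faceface_e3OfK_split`** ∕ **`faceface_e3OfK_split_sawtooth`** — the second display of the title.
* §4 `summable_linGrowth_face_mul_E2`, **`faceface_e3OfK_split_fst`** ∕ `_sawtooth` — the first-leg twin (face weight on the first leg; the `λ(y₁)`-half dies by D1's row form).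
Asserts NO value of Bałaban's tables; the constant-background face current is DISPLAYED, not valued; discharges NOTHING of (C) ∕ (C)sym ∕ (Q-L) ∕ «T2Shape» ∕ «T2Drift» ∕ (hW, hWall);
NEVER «G-an2-4 closed» as (CONV-C); NOT D1, NOT `BetaPertH`, NOT continuum, NOT Clay.  2026-08-23; no existing file touched.
-/

noncomputable section

open Finset
open scoped BigOperators
open Literature.MathematicalPhysics.QuantumFieldTheory
open Literature.MathematicalPhysics.QuantumFieldTheory.Balaban1983to89
open Literature.MathematicalPhysics.QuantumFieldTheory.Balaban1983to89.Beta
open B12Sec2to5 (l1 l1_nonneg abs_coord_le_l1)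
open ExpKernelCalculus (Site MKer Decays BiLoc Zl summable_exp_shift summable_exp_shift' l1_sub_triangle l1_sub_symm)
open AffineAveraging (box toSite unitVec)
open OneStepResolventKernel (Fib LocStencil)
open OneStepKernelFamily (KInvStep)
open BalabanStepJetsSucc (E2 decays_E2)
open Summit.QuantumFields.BalabanUV.Beta.TameKernelCalculus
open Summit.QuantumFields.BalabanUV.Beta.AxialDressingRooted (coDressKBmAt decays_coDressKBmAt_KInvStep one_le_of_neZero)
open Summit.QuantumFields.BalabanUV.Beta.SpineRooted (e3OfK locStencil_e3OfK)
open Summit.QuantumFields.BalabanUV.Beta.WardLocusRecursive (SrecAt locStencil_SrecAt)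
open Summit.QuantumFields.BalabanUV.Beta.GAN24.ValueHessianLinearGauge (summable_decay_mul_of_linGrowth tsum_E2_mul_exitFace_eq_zero' tsum_exitFace_mul_E2_eq_zero')
open Summit.QuantumFields.BalabanUV.Beta.GAN24.CubicGaugeLetterLinearGrowth (summable_shift_mul_locStencil tsum_grad_mul_e3OfK_SrecAt_inl_inl)
open Summit.QuantumFields.BalabanUV.Beta.GAN24.RespGaugeStencil (summable_faceStencil_slot decays_tsum_of_biLoc_family)

namespace Summit.QuantumFields.BalabanUV.Beta.GAN24.ExitFaceHalfVertexSplit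

variable {d : ℕ} {Lc : ℕ} [NeZero Lc]

/-! ## §1 The sawtooth of the exit-face profile -/

omit [NeZero Lc] in
/-- [folklore] **THE SAWTOOTH's GRADIENT IS `c_ν − Lc·χ_ν`**: for `λ_ν(t) := t_ν % Lc` (as a real number) and `1 ≤ Lc`,
`λ_ν(t + e_κ) − λ_ν(t) = [κ = ν]·(1 − Lc·[t_ν % Lc = Lc−1])`. -/
theorem sawtooth_grad (hLc : 1 ≤ Lc) (ν κ : Fin (d + 1)) (t : Fin (d + 1) → ℤ) :
    (((t + unitVec κ) ν % (Lc : ℤ) : ℤ) : ℝ) - ((t ν % (Lc : ℤ) : ℤ) : ℝ) =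
      if κ = ν then 1 - (Lc : ℝ) * (if t ν % (Lc : ℤ) = (Lc : ℤ) - 1 then 1 else 0) else 0 := by
  have hL0 : (0 : ℤ) < Lc := by exact_mod_cast hLc
  by_cases hκ : κ = ν
  · subst hκ
    simp only [Pi.add_apply, AffineAveraging.unitVec, Pi.single_eq_same, if_true]
    -- `(a+1) % n = a % n + 1 − n·[a % n = n−1]`
    have e1 : (Lc : ℤ) * ((t κ + 1) / (Lc : ℤ)) + (t κ + 1) % (Lc : ℤ) = t κ + 1 := Int.mul_ediv_add_emod _ _
    have e2 : (Lc : ℤ) * (t κ / (Lc : ℤ)) + t κ % (Lc : ℤ) = t κ := Int.mul_ediv_add_emod _ _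
    have e3 := PiBmConstants.int_succ_ediv hL0 (t κ)
    have key : ((t κ + 1) % (Lc : ℤ) : ℤ) = t κ % (Lc : ℤ) + 1 - (Lc : ℤ) * (if t κ % (Lc : ℤ) = (Lc : ℤ) - 1 then 1 else 0) := by
      rw [e3] at e1
      split_ifs at e1 ⊢ with h
      · linarith
      · linarith
    rw [key]
    split_ifs <;> push_cast <;> ring
  · have e : (t + unitVec κ) ν = t ν := by
      simp only [Pi.add_apply, AffineAveraging.unitVec, Pi.single_apply, if_neg (Ne.symm hκ), add_zero]
    rw [e, sub_self, if_neg hκ]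

omit [NeZero Lc] in
/-- [folklore] The sawtooth is bounded: `|t_ν % Lc| ≤ Lc + 0·|t|₁` (`1 ≤ Lc`). -/
theorem abs_sawtooth_le (hLc : 1 ≤ Lc) (ν : Fin (d + 1)) (t : Fin (d + 1) → ℤ) :
    |((t ν % (Lc : ℤ) : ℤ) : ℝ)| ≤ (Lc : ℝ) + 0 * l1 t := by
  have hL0 : (0 : ℤ) < Lc := by exact_mod_cast hLc
  have h0 : 0 ≤ t ν % (Lc : ℤ) := Int.emod_nonneg _ hL0.ne'
  have h1 : t ν % (Lc : ℤ) < Lc := Int.emod_lt_of_pos _ hL0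
  rw [zero_mul, add_zero, abs_of_nonneg (by exact_mod_cast h0)]
  exact_mod_cast h1.le

omit [NeZero Lc] in
/-- [folklore] The CENTRED sawtooth `t ↦ t_ν % Lc − c` (any constant `c`; `c = (Lc−1)∕2` makes it zero-mean over a period, the form D1 §4 wants) has the same gradient. -/
theorem csawtooth_grad (hLc : 1 ≤ Lc) (c : ℝ) (ν κ : Fin (d + 1)) (t : Fin (d + 1) → ℤ) :
    ((((t + unitVec κ) ν % (Lc : ℤ) : ℤ) : ℝ) - c) - (((t ν % (Lc : ℤ) : ℤ) : ℝ) - c) =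
      if κ = ν then 1 - (Lc : ℝ) * (if t ν % (Lc : ℤ) = (Lc : ℤ) - 1 then 1 else 0) else 0 := by
  rw [← sawtooth_grad hLc ν κ t]
  ring

omit [NeZero Lc] in
/-- [folklore] The centred sawtooth is bounded: `|t_ν % Lc − c| ≤ (Lc + |c|) + 0·|t|₁`. -/
theorem abs_csawtooth_le (hLc : 1 ≤ Lc) (c : ℝ) (ν : Fin (d + 1)) (t : Fin (d + 1) → ℤ) :
    |((t ν % (Lc : ℤ) : ℤ) : ℝ) - c| ≤ ((Lc : ℝ) + |c|) + 0 * l1 t := by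
  have h := abs_sawtooth_le hLc ν t
  rw [zero_mul, add_zero] at h ⊢
  calc |((t ν % (Lc : ℤ) : ℤ) : ℝ) - c| ≤ |((t ν % (Lc : ℤ) : ℤ) : ℝ)| + |c| := abs_sub _ _
    _ ≤ (Lc : ℝ) + |c| := by linarith

/-! ## §2 The face-background half-vertex, pointwise in the legs -/

/-- [folklore] **THE E-SECTOR HALF-VERTEX AT THE EXIT-FACE BACKGROUND, POINTWISE IN THE LEGS** (every `j`, in-block root `toSite r`, pins
`(cE, cVH) = (Lc^{d+1}, −Lc^{d+1}·½·Lc^{d+1})`, every `cΛ`): for every `λ : Site → ℝ` of linear growth with `λ(t + e_κ) − λ t = [κ = ν]·(1 − Lc·χ_ν(t))`,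
`Σ'_t χ_ν(t)·V_j ν t (z,s′)_{inl b, inl β} = Lc⁻¹·Σ'_t V_j ν t (z,s′)_{bβ} − (2Lc)⁻¹·E2 d Lc (j+1) (z,s′)_{bβ}·(λ s′ − λ z)`. -/
theorem faceSlot_e3OfK_split {r : Fin (d + 1) → ℕ} (hr : r ∈ box (d + 1) Lc) (cΛ : ℝ) (j : ℕ) (ν : Fin (d + 1)) {lam : (Fin (d + 1) → ℤ) → ℝ} {A B : ℝ}
    (hg : ∀ t, |lam t| ≤ A + B * l1 t)
    (hlam : ∀ κ t, lam (t + unitVec κ) - lam t = if κ = ν then 1 - (Lc : ℝ) * (if t ν % (Lc : ℤ) = (Lc : ℤ) - 1 then 1 else 0) else 0)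
    (z s' : Fin (d + 1) → ℤ) (b β : Fin (d + 1)) :
    (∑' t, (if t ν % (Lc : ℤ) = (Lc : ℤ) - 1 then
        e3OfK Lc (coDressKBmAt (toSite r) Lc (KInvStep (d := d) Lc j))
          (SrecAt d Lc (toSite r) ((Lc : ℝ) ^ (d + 1)) (-((Lc : ℝ) ^ (d + 1) * (1 / 2) * (Lc : ℝ) ^ (d + 1))) cΛ j) ν t z s' (Sum.inl b) (Sum.inl β) else 0)) =
      (Lc : ℝ)⁻¹ * (∑' t, e3OfK Lc (coDressKBmAt (toSite r) Lc (KInvStep (d := d) Lc j))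
          (SrecAt d Lc (toSite r) ((Lc : ℝ) ^ (d + 1)) (-((Lc : ℝ) ^ (d + 1) * (1 / 2) * (Lc : ℝ) ^ (d + 1))) cΛ j) ν t z s' (Sum.inl b) (Sum.inl β))
        - (2 * (Lc : ℝ))⁻¹ * (E2 d Lc (j + 1) z s' (Sum.inl b) (Sum.inl β) * (lam s' - lam z)) := by
  have hLc : 1 ≤ Lc := one_le_of_neZero Lc
  have hL0 : (Lc : ℝ) ≠ 0 := by exact_mod_cast (show Lc ≠ 0 by omega)
  set V := e3OfK Lc (coDressKBmAt (toSite r) Lc (KInvStep (d := d) Lc j))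
    (SrecAt d Lc (toSite r) ((Lc : ℝ) ^ (d + 1)) (-((Lc : ℝ) ^ (d + 1) * (1 / 2) * (Lc : ℝ) ^ (d + 1))) cΛ j) with hVdef
  obtain ⟨Cs, δs, hδs, hS⟩ := locStencil_SrecAt (d := d) hLc hr ((Lc : ℝ) ^ (d + 1)) (-((Lc : ℝ) ^ (d + 1) * (1 / 2) * (Lc : ℝ) ^ (d + 1))) cΛ j
  obtain ⟨C, δ, hδ, hV⟩ := locStencil_e3OfK (N := Lc) hLc (decays_coDressKBmAt_KInvStep (d := d) hr j) hS hδs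
  rw [← hVdef] at hV
  -- the indicator as `Lc⁻¹(1 − dλ_ν)`
  have hχ : ∀ t : Fin (d + 1) → ℤ, (if t ν % (Lc : ℤ) = (Lc : ℤ) - 1 then V ν t z s' (Sum.inl b) (Sum.inl β) else 0) =
      (Lc : ℝ)⁻¹ * V ν t z s' (Sum.inl b) (Sum.inl β) - (Lc : ℝ)⁻¹ * ((lam (t + unitVec ν) - lam t) * V ν t z s' (Sum.inl b) (Sum.inl β)) := by
    intro t
    rw [hlam ν t, if_pos rfl]
    split_ifs <;> field_simp <;> ring
  simp_rw [hχ]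
  -- summability of the two pieces
  have h0 : Summable fun t => V ν t z s' (Sum.inl b) (Sum.inl β) := by
    have h := summable_shift_mul_locStencil hV hδ (g := fun _ => (1 : ℝ)) (A := 1) (B := 0) (fun t => by simp) 0 ν z s' (Sum.inl b) (Sum.inl β)
    simpa using h
  have h1 : Summable fun t => (lam (t + unitVec ν) - lam t) * V ν t z s' (Sum.inl b) (Sum.inl β) := by
    have ha := summable_shift_mul_locStencil hV hδ hg (unitVec ν) ν z s' (Sum.inl b) (Sum.inl β)
    have hb := summable_shift_mul_locStencil hV hδ hg 0 ν z s' (Sum.inl b) (Sum.inl β)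
    simp only [add_zero] at hb
    exact (ha.sub hb).congr fun t => by ring
  rw [(h0.mul_left _).tsum_sub (h1.mul_left _), tsum_mul_left, tsum_mul_left]
  -- the gradient piece is the whole `κ`-sum (the other directions do not move `λ`), hence L1′
  have hκ : ∀ t : Fin (d + 1) → ℤ, (lam (t + unitVec ν) - lam t) * V ν t z s' (Sum.inl b) (Sum.inl β) =
      ∑ κ, (lam (t + unitVec κ) - lam t) * V κ t z s' (Sum.inl b) (Sum.inl β) := by
    intro t
    rw [Finset.sum_eq_single ν (fun κ _ hκ => by rw [hlam κ t, if_neg hκ, zero_mul]) (fun h => absurd (Finset.mem_univ ν) h)]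
  rw [tsum_congr hκ, hVdef, tsum_grad_mul_e3OfK_SrecAt_inl_inl hr cΛ j hg z s' b β]
  field_simp

/-- [folklore] **… THE SAWTOOTH INSTANCE** (`λ_ν(t) = t_ν % Lc`). -/
theorem faceSlot_e3OfK_split_sawtooth {r : Fin (d + 1) → ℕ} (hr : r ∈ box (d + 1) Lc) (cΛ : ℝ) (j : ℕ) (ν : Fin (d + 1))
    (z s' : Fin (d + 1) → ℤ) (b β : Fin (d + 1)) :
    (∑' t, (if t ν % (Lc : ℤ) = (Lc : ℤ) - 1 then
        e3OfK Lc (coDressKBmAt (toSite r) Lc (KInvStep (d := d) Lc j))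
          (SrecAt d Lc (toSite r) ((Lc : ℝ) ^ (d + 1)) (-((Lc : ℝ) ^ (d + 1) * (1 / 2) * (Lc : ℝ) ^ (d + 1))) cΛ j) ν t z s' (Sum.inl b) (Sum.inl β) else 0)) =
      (Lc : ℝ)⁻¹ * (∑' t, e3OfK Lc (coDressKBmAt (toSite r) Lc (KInvStep (d := d) Lc j))
          (SrecAt d Lc (toSite r) ((Lc : ℝ) ^ (d + 1)) (-((Lc : ℝ) ^ (d + 1) * (1 / 2) * (Lc : ℝ) ^ (d + 1))) cΛ j) ν t z s' (Sum.inl b) (Sum.inl β))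
        - (2 * (Lc : ℝ))⁻¹ * (E2 d Lc (j + 1) z s' (Sum.inl b) (Sum.inl β) * (((s' ν % (Lc : ℤ) : ℤ) : ℝ) - ((z ν % (Lc : ℤ) : ℤ) : ℝ))) :=
  faceSlot_e3OfK_split hr cΛ j ν (abs_sawtooth_le (one_le_of_neZero Lc) ν) (fun κ t => sawtooth_grad (one_le_of_neZero Lc) ν κ t) z s' b β

/-! ## §3 Against the exit-face leg weight the `λ(z)`-term dies -/

/-- [folklore] A row of the value Hessian against «linear-growth function × exit-face weight» is summable. -/
theorem summable_E2_mul_linGrowth_face (j : ℕ) {lam : (Fin (d + 1) → ℤ) → ℝ} {A B : ℝ} (hg : ∀ t, |lam t| ≤ A + B * l1 t) (z : Fin (d + 1) → ℤ)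
    (b β : Fin (d + 1)) :
    Summable fun s' : Fin (d + 1) → ℤ =>
      E2 d Lc (j + 1) z s' (Sum.inl b) (Sum.inl β) * (lam s' * (if s' β % (Lc : ℤ) = (Lc : ℤ) - 1 then (1 : ℝ) else 0)) := by
  obtain ⟨δ, C, hδ, -, hE⟩ := decays_E2 (d := d) (Lc := Lc) (j + 1)
  have hg' : ∀ s' : Fin (d + 1) → ℤ, |lam s' * (if s' β % (Lc : ℤ) = (Lc : ℤ) - 1 then (1 : ℝ) else 0)| ≤ |A| + |B| * l1 s' := by
    intro s'
    rw [abs_mul]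
    have h1 : |(if s' β % (Lc : ℤ) = (Lc : ℤ) - 1 then (1 : ℝ) else 0)| ≤ 1 := by split_ifs <;> simp
    have h2 : |lam s'| ≤ |A| + |B| * l1 s' :=
      (hg s').trans (add_le_add (le_abs_self A) (mul_le_mul_of_nonneg_right (le_abs_self B) (l1_nonneg s')))
    calc |lam s'| * |(if s' β % (Lc : ℤ) = (Lc : ℤ) - 1 then (1 : ℝ) else 0)| ≤ (|A| + |B| * l1 s') * 1 :=
          mul_le_mul h2 h1 (abs_nonneg _) (add_nonneg (abs_nonneg A) (mul_nonneg (abs_nonneg B) (l1_nonneg s')))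
      _ = _ := by ring
  exact summable_decay_mul_of_linGrowth (K := fun s' => E2 d Lc (j + 1) z s' (Sum.inl b) (Sum.inl β)) (C := C) hδ z (fun s' => hE z s' _ _) hg'

/-- [folklore] **THE E-SECTOR TWO-FACE HALF-VERTEX SPLIT** (the second display of the title): for `λ` as in §2,
`Σ'_{s′} χ_β(s′)·Σ'_t χ_ν(t)·V_j ν t (z,s′)_{inl b, inl β} = Lc⁻¹·Σ'_{s′} χ_β(s′)·Σ'_t V_j ν t (z,s′)_{bβ} − (2Lc)⁻¹·Σ'_{s′} E2 d Lc (j+1) (z,s′)_{bβ}·(λ s′·χ_β(s′))`. -/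
theorem faceface_e3OfK_split {r : Fin (d + 1) → ℕ} (hr : r ∈ box (d + 1) Lc) (cΛ : ℝ) (j : ℕ) (ν : Fin (d + 1)) {lam : (Fin (d + 1) → ℤ) → ℝ} {A B : ℝ}
    (hg : ∀ t, |lam t| ≤ A + B * l1 t)
    (hlam : ∀ κ t, lam (t + unitVec κ) - lam t = if κ = ν then 1 - (Lc : ℝ) * (if t ν % (Lc : ℤ) = (Lc : ℤ) - 1 then 1 else 0) else 0)
    (z : Fin (d + 1) → ℤ) (b β : Fin (d + 1)) :
    (∑' s', (if s' β % (Lc : ℤ) = (Lc : ℤ) - 1 then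
        ∑' t, (if t ν % (Lc : ℤ) = (Lc : ℤ) - 1 then
          e3OfK Lc (coDressKBmAt (toSite r) Lc (KInvStep (d := d) Lc j))
            (SrecAt d Lc (toSite r) ((Lc : ℝ) ^ (d + 1)) (-((Lc : ℝ) ^ (d + 1) * (1 / 2) * (Lc : ℝ) ^ (d + 1))) cΛ j) ν t z s' (Sum.inl b) (Sum.inl β) else 0)
        else 0)) =
      (Lc : ℝ)⁻¹ * (∑' s', (if s' β % (Lc : ℤ) = (Lc : ℤ) - 1 then
          ∑' t, e3OfK Lc (coDressKBmAt (toSite r) Lc (KInvStep (d := d) Lc j))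
            (SrecAt d Lc (toSite r) ((Lc : ℝ) ^ (d + 1)) (-((Lc : ℝ) ^ (d + 1) * (1 / 2) * (Lc : ℝ) ^ (d + 1))) cΛ j) ν t z s' (Sum.inl b) (Sum.inl β) else 0))
        - (2 * (Lc : ℝ))⁻¹ * ∑' s', E2 d Lc (j + 1) z s' (Sum.inl b) (Sum.inl β) * (lam s' * (if s' β % (Lc : ℤ) = (Lc : ℤ) - 1 then (1 : ℝ) else 0)) := by
  have hLc : 1 ≤ Lc := one_le_of_neZero Lc
  set V := e3OfK Lc (coDressKBmAt (toSite r) Lc (KInvStep (d := d) Lc j))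
    (SrecAt d Lc (toSite r) ((Lc : ℝ) ^ (d + 1)) (-((Lc : ℝ) ^ (d + 1) * (1 / 2) * (Lc : ℝ) ^ (d + 1))) cΛ j) with hVdef
  obtain ⟨Cs, δs, hδs, hS⟩ := locStencil_SrecAt (d := d) hLc hr ((Lc : ℝ) ^ (d + 1)) (-((Lc : ℝ) ^ (d + 1) * (1 / 2) * (Lc : ℝ) ^ (d + 1))) cΛ j
  obtain ⟨C, δ, hδ, hV⟩ := locStencil_e3OfK (N := Lc) hLc (decays_coDressKBmAt_KInvStep (d := d) hr j) hS hδs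
  rw [← hVdef] at hV
  have hC : 0 ≤ C := (hV 0 0).nonneg (Sum.inl 0)
  -- pointwise split (§2), then distribute the leg weight
  have hpt : ∀ s' : Fin (d + 1) → ℤ, (if s' β % (Lc : ℤ) = (Lc : ℤ) - 1 then
      ∑' t, (if t ν % (Lc : ℤ) = (Lc : ℤ) - 1 then V ν t z s' (Sum.inl b) (Sum.inl β) else 0) else 0) =
      (Lc : ℝ)⁻¹ * (if s' β % (Lc : ℤ) = (Lc : ℤ) - 1 then ∑' t, V ν t z s' (Sum.inl b) (Sum.inl β) else 0)
        - (2 * (Lc : ℝ))⁻¹ * (E2 d Lc (j + 1) z s' (Sum.inl b) (Sum.inl β) * (lam s' * (if s' β % (Lc : ℤ) = (Lc : ℤ) - 1 then (1 : ℝ) else 0)))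
        + (2 * (Lc : ℝ))⁻¹ * lam z * (E2 d Lc (j + 1) z s' (Sum.inl b) (Sum.inl β) * (if s' β % (Lc : ℤ) = (Lc : ℤ) - 1 then (1 : ℝ) else 0)) := by
    intro s'
    split_ifs with hs
    · rw [hVdef, faceSlot_e3OfK_split hr cΛ j ν hg hlam z s' b β, ← hVdef]
      ring
    · ring
  simp_rw [hpt]
  -- summability of the three pieces
  have hA : Summable fun s' : Fin (d + 1) → ℤ => (if s' β % (Lc : ℤ) = (Lc : ℤ) - 1 then ∑' t, V ν t z s' (Sum.inl b) (Sum.inl β) else 0) := by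
    have hdec := decays_tsum_of_biLoc_family (T := fun t => V ν t) (fun t => hV ν t) hδ hC
    refine Summable.of_norm_bounded ((summable_exp_shift (half_pos hδ) z).mul_left (C * Zl (d + 1) (δ / 2))) fun s' => ?_
    rw [Real.norm_eq_abs]
    split_ifs
    · exact hdec z s' (Sum.inl b) (Sum.inl β)
    · rw [abs_zero]; exact (abs_nonneg _).trans (hdec z s' (Sum.inl b) (Sum.inl β))
  have hB := summable_E2_mul_linGrowth_face (Lc := Lc) j hg z b β
  have hCz := (summable_E2_mul_linGrowth_face (Lc := Lc) j (lam := fun _ => (1 : ℝ)) (A := 1) (B := 0) (fun t => by simp) z b β)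
  simp only [one_mul] at hCz
  rw [((hA.mul_left _).sub (hB.mul_left _)).tsum_add (hCz.mul_left _), (hA.mul_left _).tsum_sub (hB.mul_left _), tsum_mul_left, tsum_mul_left,
    tsum_mul_left, tsum_E2_mul_exitFace_eq_zero' (Lc := Lc) (j + 1) hLc b β z 1]
  simp only [mul_zero, add_zero]

/-- [folklore] **… THE SAWTOOTH INSTANCE**: `Σ'_{s′} χ_β(s′)·Σ'_t χ_ν(t)·V_j ν t (z,s′)_{bβ} = Lc⁻¹·Σ'_{s′} χ_β(s′)·Σ'_t V_j ν t (z,s′)_{bβ} −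
(2Lc)⁻¹·Σ'_{s′} E2_{j+1}(z,s′)_{bβ}·((s′_ν % Lc)·χ_β(s′))`. -/
theorem faceface_e3OfK_split_sawtooth {r : Fin (d + 1) → ℕ} (hr : r ∈ box (d + 1) Lc) (cΛ : ℝ) (j : ℕ) (ν : Fin (d + 1)) (z : Fin (d + 1) → ℤ)
    (b β : Fin (d + 1)) :
    (∑' s', (if s' β % (Lc : ℤ) = (Lc : ℤ) - 1 then
        ∑' t, (if t ν % (Lc : ℤ) = (Lc : ℤ) - 1 then
          e3OfK Lc (coDressKBmAt (toSite r) Lc (KInvStep (d := d) Lc j))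
            (SrecAt d Lc (toSite r) ((Lc : ℝ) ^ (d + 1)) (-((Lc : ℝ) ^ (d + 1) * (1 / 2) * (Lc : ℝ) ^ (d + 1))) cΛ j) ν t z s' (Sum.inl b) (Sum.inl β) else 0)
        else 0)) =
      (Lc : ℝ)⁻¹ * (∑' s', (if s' β % (Lc : ℤ) = (Lc : ℤ) - 1 then
          ∑' t, e3OfK Lc (coDressKBmAt (toSite r) Lc (KInvStep (d := d) Lc j))
            (SrecAt d Lc (toSite r) ((Lc : ℝ) ^ (d + 1)) (-((Lc : ℝ) ^ (d + 1) * (1 / 2) * (Lc : ℝ) ^ (d + 1))) cΛ j) ν t z s' (Sum.inl b) (Sum.inl β) else 0))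
        - (2 * (Lc : ℝ))⁻¹ * ∑' s', E2 d Lc (j + 1) z s' (Sum.inl b) (Sum.inl β) *
            ((((s' ν % (Lc : ℤ) : ℤ) : ℝ)) * (if s' β % (Lc : ℤ) = (Lc : ℤ) - 1 then (1 : ℝ) else 0)) :=
  faceface_e3OfK_split hr cΛ j ν (abs_sawtooth_le (one_le_of_neZero Lc) ν) (fun κ t => sawtooth_grad (one_le_of_neZero Lc) ν κ t) z b β


/-! ## §4 The first-leg twin: face weight on the FIRST leg, open second leg -/

/-- [folklore] A column of the value Hessian against «linear-growth function × exit-face weight» in the ROW variable is summable. -/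
theorem summable_linGrowth_face_mul_E2 (j : ℕ) {lam : (Fin (d + 1) → ℤ) → ℝ} {A B : ℝ} (hg : ∀ t, |lam t| ≤ A + B * l1 t) (y₁ : Fin (d + 1) → ℤ)
    (α a : Fin (d + 1)) :
    Summable fun y : Fin (d + 1) → ℤ =>
      (lam y * (if y α % (Lc : ℤ) = (Lc : ℤ) - 1 then (1 : ℝ) else 0)) * E2 d Lc (j + 1) y y₁ (Sum.inl α) (Sum.inl a) := by
  obtain ⟨δ, C, hδ, -, hE⟩ := decays_E2 (d := d) (Lc := Lc) (j + 1)
  have hg' : ∀ y : Fin (d + 1) → ℤ, |lam y * (if y α % (Lc : ℤ) = (Lc : ℤ) - 1 then (1 : ℝ) else 0)| ≤ |A| + |B| * l1 y := by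
    intro y
    rw [abs_mul]
    have h1 : |(if y α % (Lc : ℤ) = (Lc : ℤ) - 1 then (1 : ℝ) else 0)| ≤ 1 := by split_ifs <;> simp
    have h2 : |lam y| ≤ |A| + |B| * l1 y :=
      (hg y).trans (add_le_add (le_abs_self A) (mul_le_mul_of_nonneg_right (le_abs_self B) (l1_nonneg y)))
    calc |lam y| * |(if y α % (Lc : ℤ) = (Lc : ℤ) - 1 then (1 : ℝ) else 0)| ≤ (|A| + |B| * l1 y) * 1 :=
          mul_le_mul h2 h1 (abs_nonneg _) (add_nonneg (abs_nonneg A) (mul_nonneg (abs_nonneg B) (l1_nonneg y)))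
      _ = _ := by ring
  have h := summable_decay_mul_of_linGrowth (K := fun y => E2 d Lc (j + 1) y y₁ (Sum.inl α) (Sum.inl a)) (C := C) hδ y₁ (fun y => ?_) hg'
  · exact h.congr fun y => mul_comm _ _
  · rw [l1_sub_symm]; exact hE y y₁ _ _

/-- [folklore] **THE FIRST-LEG TWIN OF THE TWO-FACE SPLIT** (face weight `χ_α` on the FIRST leg `y`, open second leg `y₁`; the `λ(y₁)`-half dies by D1's row form):
`Σ'_y χ_α(y)·Σ'_t χ_μ(t)·V_j μ t (y,y₁)_{inl α, inl a} = Lc⁻¹·Σ'_y χ_α(y)·Σ'_t V_j μ t (y,y₁)_{αa} + (2Lc)⁻¹·Σ'_y (λ y·χ_α(y))·E2 d Lc (j+1) (y,y₁)_{αa}`. -/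
theorem faceface_e3OfK_split_fst {r : Fin (d + 1) → ℕ} (hr : r ∈ box (d + 1) Lc) (cΛ : ℝ) (j : ℕ) (μ : Fin (d + 1)) {lam : (Fin (d + 1) → ℤ) → ℝ} {A B : ℝ}
    (hg : ∀ t, |lam t| ≤ A + B * l1 t)
    (hlam : ∀ κ t, lam (t + unitVec κ) - lam t = if κ = μ then 1 - (Lc : ℝ) * (if t μ % (Lc : ℤ) = (Lc : ℤ) - 1 then 1 else 0) else 0)
    (y₁ : Fin (d + 1) → ℤ) (α a : Fin (d + 1)) :
    (∑' y, (if y α % (Lc : ℤ) = (Lc : ℤ) - 1 then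
        ∑' t, (if t μ % (Lc : ℤ) = (Lc : ℤ) - 1 then
          e3OfK Lc (coDressKBmAt (toSite r) Lc (KInvStep (d := d) Lc j))
            (SrecAt d Lc (toSite r) ((Lc : ℝ) ^ (d + 1)) (-((Lc : ℝ) ^ (d + 1) * (1 / 2) * (Lc : ℝ) ^ (d + 1))) cΛ j) μ t y y₁ (Sum.inl α) (Sum.inl a) else 0)
        else 0)) =
      (Lc : ℝ)⁻¹ * (∑' y, (if y α % (Lc : ℤ) = (Lc : ℤ) - 1 then
          ∑' t, e3OfK Lc (coDressKBmAt (toSite r) Lc (KInvStep (d := d) Lc j))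
            (SrecAt d Lc (toSite r) ((Lc : ℝ) ^ (d + 1)) (-((Lc : ℝ) ^ (d + 1) * (1 / 2) * (Lc : ℝ) ^ (d + 1))) cΛ j) μ t y y₁ (Sum.inl α) (Sum.inl a) else 0))
        + (2 * (Lc : ℝ))⁻¹ * ∑' y, (lam y * (if y α % (Lc : ℤ) = (Lc : ℤ) - 1 then (1 : ℝ) else 0)) * E2 d Lc (j + 1) y y₁ (Sum.inl α) (Sum.inl a) := by
  have hLc : 1 ≤ Lc := one_le_of_neZero Lc
  set V := e3OfK Lc (coDressKBmAt (toSite r) Lc (KInvStep (d := d) Lc j))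
    (SrecAt d Lc (toSite r) ((Lc : ℝ) ^ (d + 1)) (-((Lc : ℝ) ^ (d + 1) * (1 / 2) * (Lc : ℝ) ^ (d + 1))) cΛ j) with hVdef
  obtain ⟨Cs, δs, hδs, hS⟩ := locStencil_SrecAt (d := d) hLc hr ((Lc : ℝ) ^ (d + 1)) (-((Lc : ℝ) ^ (d + 1) * (1 / 2) * (Lc : ℝ) ^ (d + 1))) cΛ j
  obtain ⟨C, δ, hδ, hV⟩ := locStencil_e3OfK (N := Lc) hLc (decays_coDressKBmAt_KInvStep (d := d) hr j) hS hδs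
  rw [← hVdef] at hV
  have hC : 0 ≤ C := (hV 0 0).nonneg (Sum.inl 0)
  have hpt : ∀ y : Fin (d + 1) → ℤ, (if y α % (Lc : ℤ) = (Lc : ℤ) - 1 then
      ∑' t, (if t μ % (Lc : ℤ) = (Lc : ℤ) - 1 then V μ t y y₁ (Sum.inl α) (Sum.inl a) else 0) else 0) =
      (Lc : ℝ)⁻¹ * (if y α % (Lc : ℤ) = (Lc : ℤ) - 1 then ∑' t, V μ t y y₁ (Sum.inl α) (Sum.inl a) else 0)
        + (2 * (Lc : ℝ))⁻¹ * ((lam y * (if y α % (Lc : ℤ) = (Lc : ℤ) - 1 then (1 : ℝ) else 0)) * E2 d Lc (j + 1) y y₁ (Sum.inl α) (Sum.inl a))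
        - (2 * (Lc : ℝ))⁻¹ * lam y₁ * ((if y α % (Lc : ℤ) = (Lc : ℤ) - 1 then (1 : ℝ) else 0) * E2 d Lc (j + 1) y y₁ (Sum.inl α) (Sum.inl a)) := by
    intro y
    split_ifs with hy
    · rw [hVdef, faceSlot_e3OfK_split hr cΛ j μ hg hlam y y₁ α a, ← hVdef]
      ring
    · ring
  simp_rw [hpt]
  have hA : Summable fun y : Fin (d + 1) → ℤ => (if y α % (Lc : ℤ) = (Lc : ℤ) - 1 then ∑' t, V μ t y y₁ (Sum.inl α) (Sum.inl a) else 0) := by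
    have hdec := decays_tsum_of_biLoc_family (T := fun t => V μ t) (fun t => hV μ t) hδ hC
    refine Summable.of_norm_bounded ((summable_exp_shift' (half_pos hδ) y₁).mul_left (C * Zl (d + 1) (δ / 2))) fun y => ?_
    rw [Real.norm_eq_abs]
    split_ifs
    · exact hdec y y₁ (Sum.inl α) (Sum.inl a)
    · rw [abs_zero]; exact (abs_nonneg _).trans (hdec y y₁ (Sum.inl α) (Sum.inl a))
  have hB := summable_linGrowth_face_mul_E2 (Lc := Lc) j hg y₁ α a
  have hCz := summable_linGrowth_face_mul_E2 (Lc := Lc) j (lam := fun _ => (1 : ℝ)) (A := 1) (B := 0) (fun t => by simp) y₁ α a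
  simp only [one_mul] at hCz
  rw [((hA.mul_left _).add (hB.mul_left _)).tsum_sub (hCz.mul_left _), (hA.mul_left _).tsum_add (hB.mul_left _), tsum_mul_left, tsum_mul_left,
    tsum_mul_left, tsum_exitFace_mul_E2_eq_zero' (Lc := Lc) (j + 1) hLc a α y₁ 1]
  simp only [mul_zero, sub_zero]

/-- [folklore] **… THE SAWTOOTH INSTANCE of the first-leg twin** (`λ_μ(t) = t_μ % Lc`). -/
theorem faceface_e3OfK_split_fst_sawtooth {r : Fin (d + 1) → ℕ} (hr : r ∈ box (d + 1) Lc) (cΛ : ℝ) (j : ℕ) (μ : Fin (d + 1)) (y₁ : Fin (d + 1) → ℤ)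
    (α a : Fin (d + 1)) :
    (∑' y, (if y α % (Lc : ℤ) = (Lc : ℤ) - 1 then
        ∑' t, (if t μ % (Lc : ℤ) = (Lc : ℤ) - 1 then
          e3OfK Lc (coDressKBmAt (toSite r) Lc (KInvStep (d := d) Lc j))
            (SrecAt d Lc (toSite r) ((Lc : ℝ) ^ (d + 1)) (-((Lc : ℝ) ^ (d + 1) * (1 / 2) * (Lc : ℝ) ^ (d + 1))) cΛ j) μ t y y₁ (Sum.inl α) (Sum.inl a) else 0)
        else 0)) =
      (Lc : ℝ)⁻¹ * (∑' y, (if y α % (Lc : ℤ) = (Lc : ℤ) - 1 then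
          ∑' t, e3OfK Lc (coDressKBmAt (toSite r) Lc (KInvStep (d := d) Lc j))
            (SrecAt d Lc (toSite r) ((Lc : ℝ) ^ (d + 1)) (-((Lc : ℝ) ^ (d + 1) * (1 / 2) * (Lc : ℝ) ^ (d + 1))) cΛ j) μ t y y₁ (Sum.inl α) (Sum.inl a) else 0))
        + (2 * (Lc : ℝ))⁻¹ * ∑' y, ((((y μ % (Lc : ℤ) : ℤ) : ℝ)) * (if y α % (Lc : ℤ) = (Lc : ℤ) - 1 then (1 : ℝ) else 0)) *
            E2 d Lc (j + 1) y y₁ (Sum.inl α) (Sum.inl a) :=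
  faceface_e3OfK_split_fst hr cΛ j μ (abs_sawtooth_le (one_le_of_neZero Lc) μ) (fun κ t => sawtooth_grad (one_le_of_neZero Lc) μ κ t) y₁ α a

end Summit.QuantumFields.BalabanUV.Beta.GAN24.ExitFaceHalfVertexSplit

end
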